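import Mathlib
import HarnessLib
import Literature.Analysis.Quadrature.PolyaConvergence

/-!
# Pólya's theorem on the convergence of integration rules: the necessity of uniform boundedness
(Davis–Rabinowitz, *Methods of Numerical Integration*, 2nd ed. 1984, Sect. 2.7.8 "Convergence of
Gaussian Rules":
PÓLYA'S THEOREM (2.7.8.10)–(2.7.8.12), the necessity half, and the theorem as an equivalence)

DR84 state PÓLYA'S THEOREM: let `L_n f = Σ_{k=1}^{m_n} w_{nk} f(x_{nk})` with abscissas in `[a,
b]`; then `L_n f → ∫_a^b f` for every `f ∈ C[a, b]` ((2.7.8.10)) **if and only if** `L_n(x^j) →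
∫_a^b x^j` for every `j`
((2.7.8.11), convergence of the moments) **and** `Σ_k |w_{nk}| ≤ M` for all `n` ((2.7.8.12),
uniform boundedness).
The tree file `Literature.Analysis.Quadrature.PolyaConvergence` proves the sufficiency half
(`tendsto_sum_mul_of_continuousOn`) and records that the necessity "(2.7.8.10) ⟹ (2.7.8.12), uniform
boundedness" is not treated there. This file supplies it and states the theorem as an `iff`.

## Main statements (rules `L_n f = Σ_{x ∈ S n} W n x · f x`, `S n ⊆ [a, b]`, as in
`PolyaConvergence`)

* `exists_continuousOn_sum_mul_eq_sum_abs` — the test function of the classical proof: a `g`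
  continuous on `[a, b]` with `|g| ≤ 1` there and `L_n g = Σ_{x ∈ S n} |W n x|` (Tietze extension
  of `x ↦ sign (W n x)` from the finite node set).
* `sum_abs_le_of_forall_continuousOn_bounded` — if `(L_n f)_n` is bounded for every `f` continuous
  on `[a, b]`, then `Σ_{x ∈ S n} |W n x| ≤ M` for some `M` and every `n` (principle of uniform
  boundedness on `C([a, b])`).
* `sum_abs_le_of_forall_continuousOn_tendsto` — (2.7.8.10) ⟹ (2.7.8.12).
* `tendsto_pow_of_forall_continuousOn_tendsto` — (2.7.8.10) ⟹ (2.7.8.11) (monomials are continuous).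
* `polya_iff` — PÓLYA'S THEOREM: (2.7.8.10) ⟺ (2.7.8.11) ∧ (2.7.8.12).

## Proof route

`L_n` is realised as the continuous linear functional `Σ_{x ∈ S n} W n x • ev_x` on the Banach space
`C(Icc a b, ℝ)` (sup norm).  Its norm is at least `Σ |W n x|`, witnessed by the test function above
(`ContinuousMap.exists_extension_forall_mem_of_isClosedEmbedding`, Tietze).  A continuous
`f : ℝ → ℝ` on `[a, b]`
and an element of `C(Icc a b, ℝ)` correspond through restriction / `Set.IccExtend`, so the
hypothesis says the family `(L_n)` is pointwise bounded; Banach–Steinhaus (`banach_steinhaus`)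
bounds the norms uniformly.

Hypotheses: `a ≤ b`; abscissas in `[a, b]`.  The weights and abscissas are otherwise arbitrary (in
particular the number of nodes `#(S n)` is unrestricted), exactly as in (2.7.8.10)–(2.7.8.12).
-/

namespace Literature.Analysis.Quadrature

open Set MeasureTheory Finset Filter
open scoped Topology

section PolyaNecessity

variable {S : ℕ → Finset ℝ} {W : ℕ → ℝ → ℝ} {a b : ℝ}

/-- [folklore] The rule `L_n` as a continuous linear functional on `C([a, b])`:
`Σ_{x ∈ S n} W n x • ev_x` (the sum runs over the attached finset so that each node carries its
membership proof in `[a, b]`). -/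
private noncomputable def ruleCLM (S : ℕ → Finset ℝ) (W : ℕ → ℝ → ℝ) (a b : ℝ)
    (hS : ∀ n, ∀ x ∈ S n, x ∈ Icc a b) (n : ℕ) : C(Icc a b, ℝ) →L[ℝ] ℝ :=
  ∑ x ∈ (S n).attach, W n x • ContinuousMap.evalCLM ℝ (⟨x.1, hS n x.1 x.2⟩ : Icc a b)

/-- [folklore] Evaluation of `ruleCLM`. -/
private theorem ruleCLM_apply (hS : ∀ n, ∀ x ∈ S n, x ∈ Icc a b) (n : ℕ) (f : C(Icc a b, ℝ)) :
    ruleCLM S W a b hS n f = ∑ x ∈ (S n).attach, W n x * f ⟨x.1, hS n x.1 x.2⟩ := by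
  simp only [ruleCLM, FunLike.coe_sum, Finset.sum_apply, FunLike.coe_smul, Pi.smul_apply,
    ContinuousMap.evalCLM_apply, smul_eq_mul]

/-- [folklore] `ruleCLM` on the restriction of a function `f : ℝ → ℝ` is the rule sum `Σ_{x ∈ S n}
W n x · f x`. -/
private theorem ruleCLM_apply_eq_sum (hS : ∀ n, ∀ x ∈ S n, x ∈ Icc a b) (n : ℕ) (f : C(Icc a b, ℝ))
    (F : ℝ → ℝ) (hF : ∀ x (hx : x ∈ S n), F x = f ⟨x, hS n x hx⟩) :
    ruleCLM S W a b hS n f = ∑ x ∈ S n, W n x * F x := by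
  rw [ruleCLM_apply, ← Finset.sum_attach (S n) (fun x => W n x * F x)]
  exact Finset.sum_congr rfl fun x _ => by rw [hF x.1 x.2]

/-- **The test function.** For each `n` there is a `g`, continuous on `[a, b]` with `|g| ≤ 1`
there, taking the value `sign (W n x)` (`+1` when `W n x ≥ 0`, `-1` otherwise) at every node, so
that `L_n g = Σ_{x ∈ S n} |W n x|`: the Tietze extension of the sign pattern from the finite node
set.  This is the step showing `‖L_n‖ ≥ Σ_k |w_{nk}|` in the proof of the necessity half of Pólya's
theorem.
[cite: DavisRabinowitz1984, Sect. 2.7.8 (2.7.8.10)-(2.7.8.12)] -/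
theorem exists_continuousOn_sum_mul_eq_sum_abs (hab : a ≤ b) (hS : ∀ n, ∀ x ∈ S n, x ∈ Icc a b)
    (n : ℕ) :
    ∃ g : ℝ → ℝ, ContinuousOn g (Icc a b) ∧ (∀ x ∈ Icc a b, |g x| ≤ 1) ∧
      ∑ x ∈ S n, W n x * g x = ∑ x ∈ S n, |W n x| := by
  classical
  -- the node set as a (finite, hence discrete and compact) space, closed-embedded in `[a, b]`
  let e : (S n) → Icc a b := fun x => ⟨x.1, hS n x.1 x.2⟩
  have he : _root_.Topology.IsClosedEmbedding e := by
    refine Continuous.isClosedEmbedding (continuous_subtype_val.subtype_mk _) fun x y hxy => ?_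
    exact Subtype.ext (by simpa [e] using congrArg Subtype.val hxy)
  let t : (S n) → ℝ := fun x => if 0 ≤ W n x then 1 else -1
  have ht : ∀ x, t x ∈ Icc (-1 : ℝ) 1 := fun x => by
    simp only [t]; split_ifs <;> simp
  let g₀ : C((S n), ℝ) := ⟨t, continuous_of_discreteTopology⟩
  obtain ⟨g, hg1, hge⟩ := ContinuousMap.exists_extension_forall_mem_of_isClosedEmbedding g₀
    (t := Icc (-1 : ℝ) 1) (fun x => ht x) ⟨0, by simp⟩ he
  have hgt : ∀ x : (S n), g (e x) = t x := fun x => by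
    simpa [g₀] using congrFun hge x
  -- pull `g` back to a function on `ℝ` through `Set.IccExtend`
  refine ⟨IccExtend hab g, (g.continuous.Icc_extend' (h := hab)).continuousOn, fun x hx => ?_, ?_⟩
  · rw [IccExtend_of_mem hab g hx]
    exact abs_le.2 ⟨(hg1 _).1, (hg1 _).2⟩
  · refine Finset.sum_congr rfl fun x hx => ?_
    rw [IccExtend_of_mem hab g (hS n x hx)]
    have hx' : g ⟨x, hS n x hx⟩ = t ⟨x, hx⟩ := hgt ⟨x, hx⟩
    rw [hx']
    simp only [t]
    split_ifs with h
    · rw [mul_one, abs_of_nonneg h]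
    · rw [mul_neg_one, abs_of_neg (lt_of_not_ge h)]

/-- [folklore] The operator norm of `L_n` on `C([a, b])` is at least `Σ_{x ∈ S n} |W n x|`. -/
private theorem sum_abs_le_opNorm (hab : a ≤ b) (hS : ∀ n, ∀ x ∈ S n, x ∈ Icc a b) (n : ℕ) :
    ∑ x ∈ S n, |W n x| ≤ ‖ruleCLM S W a b hS n‖ := by
  obtain ⟨g, hgc, hg1, hsum⟩ := exists_continuousOn_sum_mul_eq_sum_abs (W := W) hab hS n
  -- restrict `g` to an element of `C(Icc a b, ℝ)` of norm `≤ 1`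
  let G : C(Icc a b, ℝ) := ⟨fun x => g x.1, hgc.restrict⟩
  have hG : ‖G‖ ≤ 1 := by
    rw [ContinuousMap.norm_le _ zero_le_one]
    intro x
    rw [Real.norm_eq_abs]
    exact hg1 x.1 x.2
  have hLG : ruleCLM S W a b hS n G = ∑ x ∈ S n, |W n x| := by
    rw [ruleCLM_apply_eq_sum hS n G g fun x _ => rfl, hsum]
  calc ∑ x ∈ S n, |W n x| = ruleCLM S W a b hS n G := hLG.symm
    _ ≤ ‖ruleCLM S W a b hS n G‖ := Real.le_norm_self _
    _ ≤ ‖ruleCLM S W a b hS n‖ * ‖G‖ := ContinuousLinearMap.le_opNorm _ _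
    _ ≤ ‖ruleCLM S W a b hS n‖ := mul_le_of_le_one_right (norm_nonneg (ruleCLM S W a b hS n)) hG

/-- **Uniform boundedness of the weights from pointwise boundedness** (the necessity half of
Pólya's theorem in its natural strength): if for every `f` continuous on `[a, b]` the sequence
`(L_n f)_n` is bounded, then `Σ_{x ∈ S n} |W n x| ≤ M` for some `M` and all `n` ((2.7.8.12)). 
Principle of uniform boundedness
(Banach–Steinhaus) on the Banach space `C([a, b])`, with `‖L_n‖ ≥ Σ_x |W n x|` from the test
function.
[cite: DavisRabinowitz1984, Sect. 2.7.8 (2.7.8.10)-(2.7.8.12)] -/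
theorem sum_abs_le_of_forall_continuousOn_bounded (hab : a ≤ b) (hS : ∀ n, ∀ x ∈ S n, x ∈ Icc a b)
    (hbdd : ∀ f : ℝ → ℝ, ContinuousOn f (Icc a b) → ∃ C, ∀ n, |∑ x ∈ S n, W n x * f x| ≤ C) :
    ∃ M, ∀ n, ∑ x ∈ S n, |W n x| ≤ M := by
  have hpt : ∀ f : C(Icc a b, ℝ), ∃ C, ∀ n, ‖ruleCLM S W a b hS n f‖ ≤ C := by
    intro f
    obtain ⟨C, hC⟩ := hbdd (IccExtend hab f) (f.continuous.Icc_extend' (h := hab)).continuousOn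
    refine ⟨C, fun n => ?_⟩
    rw [Real.norm_eq_abs,
      ruleCLM_apply_eq_sum hS n f (IccExtend hab f) fun x hx => IccExtend_of_mem hab f (hS n x hx)]
    exact hC n
  obtain ⟨C', hC'⟩ := banach_steinhaus hpt
  exact ⟨C', fun n => (sum_abs_le_opNorm hab hS n).trans (hC' n)⟩

/-- **PÓLYA'S THEOREM, necessity of (2.7.8.12)**: if `L_n f → ∫_a^b f` for every `f ∈ C[a, b]`
((2.7.8.10)), then there exists a constant `M` such that `Σ_{x ∈ S n} |W n x| ≤ M` for all `n`
((2.7.8.12)).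
[cite: DavisRabinowitz1984, Sect. 2.7.8 (2.7.8.10)-(2.7.8.12)] -/
theorem sum_abs_le_of_forall_continuousOn_tendsto (hab : a ≤ b) (hS : ∀ n, ∀ x ∈ S n, x ∈ Icc a b)
    (hconv : ∀ f : ℝ → ℝ, ContinuousOn f (Icc a b) →
      Tendsto (fun n => ∑ x ∈ S n, W n x * f x) atTop (𝓝 (∫ t in a..b, f t))) :
    ∃ M, ∀ n, ∑ x ∈ S n, |W n x| ≤ M := by
  refine sum_abs_le_of_forall_continuousOn_bounded hab hS fun f hf => ?_
  obtain ⟨C, hC⟩ :=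
    isBounded_iff_forall_norm_le.1 (Metric.isBounded_range_of_tendsto _ (hconv f hf))
  exact ⟨C, fun n => by simpa only [Real.norm_eq_abs] using hC _ (Set.mem_range_self n)⟩

/-- **PÓLYA'S THEOREM, necessity of (2.7.8.11)**: if `L_n f → ∫_a^b f` for every `f ∈ C[a, b]`
((2.7.8.10)), then the moments converge, `L_n(x^j) → ∫_a^b x^j` for every `j` ((2.7.8.11)) —
monomials are continuous.
[cite: DavisRabinowitz1984, Sect. 2.7.8 (2.7.8.10)-(2.7.8.11)] -/
theorem tendsto_pow_of_forall_continuousOn_tendsto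
    (hconv : ∀ f : ℝ → ℝ, ContinuousOn f (Icc a b) →
      Tendsto (fun n => ∑ x ∈ S n, W n x * f x) atTop (𝓝 (∫ t in a..b, f t))) (j : ℕ) :
    Tendsto (fun n => ∑ x ∈ S n, W n x * x ^ j) atTop (𝓝 (∫ t in a..b, t ^ j)) :=
  hconv (fun t => t ^ j) (continuous_pow j).continuousOn

/-- **PÓLYA'S THEOREM** ((2.7.8.10) ⟺ (2.7.8.11) ∧ (2.7.8.12)): let `L_n f = Σ_{x ∈ S n} W n x · f
x` with all abscissas in `[a, b]`, `a ≤ b`.  Then `L_n f → ∫_a^b f` for every `f` continuous on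
`[a, b]` if and only if the moments converge, `L_n(x^j) → ∫_a^b x^j` for every `j`, and the
absolute weight sums are uniformly bounded, `Σ_{x ∈ S n} |W n x| ≤ M` for all `n`.  Sufficiency is
`tendsto_sum_mul_of_continuousOn`
(`Literature.Analysis.Quadrature.PolyaConvergence`); necessity is the two theorems above.
[cite: DavisRabinowitz1984, Sect. 2.7.8 (2.7.8.10)-(2.7.8.12)] -/
theorem polya_iff (hab : a ≤ b) (hS : ∀ n, ∀ x ∈ S n, x ∈ Icc a b) :
    (∀ f : ℝ → ℝ, ContinuousOn f (Icc a b) →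
        Tendsto (fun n => ∑ x ∈ S n, W n x * f x) atTop (𝓝 (∫ t in a..b, f t))) ↔
      (∀ j : ℕ, Tendsto (fun n => ∑ x ∈ S n, W n x * x ^ j) atTop (𝓝 (∫ t in a..b, t ^ j))) ∧
        ∃ M, ∀ n, ∑ x ∈ S n, |W n x| ≤ M :=
  ⟨fun h => ⟨tendsto_pow_of_forall_continuousOn_tendsto h,
      sum_abs_le_of_forall_continuousOn_tendsto hab hS h⟩,
    fun h f hf => by
      obtain ⟨hmom, M, hM⟩ := h
      exact tendsto_sum_mul_of_continuousOn hab hS hM hmom hf⟩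

end PolyaNecessity

end Literature.Analysis.Quadrature
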